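import Literature.Probability.Percolation.QuadDualExploration
import HarnessLib

/-!
# The lowest crossing of a charted quad: definitions (Schramm–Smirnov, proof of Lemma 6.1)

Topic `Probability/Percolation`.  Definitions for the proof of the continuity lemmas of
O. Schramm, S. Smirnov, *On the scaling limits of planar percolation*, Ann. Probab. 39 (2011),
Lemma 6.1 (cases (2), (3)) and Lemma 5.1, for bond percolation on `δℤ²` drawn in the plane and
quads charted by a homeomorphism `G : ℂ ≃ₜ ℂ` of straight rectangles, on top of the explored
region `Λ` of `QuadDualExploration.lean` (a `Frame` = chart + rectangle data + mesh):

* `ChartCrossed G a b c d δ ω`, `Frame.Crossed` — the charted rectangle has an open crossing;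
* `Frame.frontierSet`, `Frame.IsFrontierCrossing` — the frontier `closure Λ ∖ Λ` and the lowest
  crossing (a continuum in it joining the vertical sides);
* `Frame.wallTrace`, `Frame.wallTop`, `Frame.wallPt` — the endpoint `x` of the lowest crossing
  on the right side (the highest point of `closure Λ` there);
* `Frame.bigRect`, `Frame.sepSet`, `Frame.JoinedBelow`, `Frame.gapSeg`, `Frame.wideRect`,
  `Frame.corner` — the rectangles and separating sets of the "thin place" argument;
* `Frame.Calib` — the quantitative hypotheses of one move; `Frame.armCentre`;
* `swapC`, `negRe`, `negIm` — reflections of the chart; `dualShift δ = δ(½, ½)`.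

The theorems are in `QuadLowestCrossingProofs.lean`; everything there is proved, and no named
fact is introduced here or there.

## References

* O. Schramm, S. Smirnov, Ann. Probab. 39 (2011) 1768–1814, arXiv:1101.5820, proof of Lemma 6.1.
  [SchrammSmirnov2011]
* B. Bollobás, O. Riordan, *Percolation* (2006), Ch. 1 p. 15 (the dual lattice `ℤ² + (½,½)`).
  [BollobasRiordan2006]
-/

noncomputable section

open Set Metric Complex
open _root_.Topology
open Literature.Probability.LatticeModels

namespace Literature.Probability.Percolation

namespace SSContinuity

/-- **The chart rectangle `[a,b] × [c,d]` is crossed through `G`**: some continuum `K` of the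
chart rectangle, drawn by `G` into the open edges of `ω` at mesh `δ`, meets both vertical sides
(`G '' K` is then an open crossing of the quad `G([a,b] × [c,d])` in the sense of Schramm–Smirnov,
sides `0`, `2` being the images of the vertical sides). [cite: SchrammSmirnov2011, §1.3] -/
def ChartCrossed (G : ℂ ≃ₜ ℂ) (a b c d δ : ℝ) (ω : BondConfig (Site 2)) : Prop :=
  ∃ K ⊆ Icc a b ×ℂ Icc c d, IsCompact K ∧ IsConnected K ∧
    (∀ u ∈ K, G u ∈ openEdgeUnion δ ω) ∧ (∃ u ∈ K, u.re = a) ∧ ∃ u ∈ K, u.re = b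

namespace Frame

variable (Φ : Frame)

/-- **`G(R)` is crossed** for the frame's chart and the rectangle `[a, b'] × [c, d]`
(`ChartCrossed` with the frame's data; `b'` free so as to serve both `R'` and `R`).
[cite: SchrammSmirnov2011, §1.3] -/
def Crossed (b' : ℝ) (ω : BondConfig (Site 2)) : Prop := ChartCrossed Φ.G Φ.a b' Φ.c Φ.d Φ.δ ω

/-- The frontier `closure Λ ∖ Λ` of the explored region. [cite: SchrammSmirnov2011, proof of Lemma 6.1] -/
def frontierSet (ω : BondConfig (Site 2)) : Set ℂ := closure (Φ.explored ω) \ Φ.explored ω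

/-- **A frontier crossing** ("the lowest crossing `γ`"): a continuum inside the frontier of `Λ`
meeting both vertical sides of `R'`. [cite: SchrammSmirnov2011, proof of Lemma 6.1] -/
def IsFrontierCrossing (ω : BondConfig (Site 2)) (Γ : Set ℂ) : Prop :=
  Γ ⊆ Φ.frontierSet ω ∧ IsCompact Γ ∧ IsConnected Γ ∧ (∃ u ∈ Γ, u.re = Φ.a) ∧ ∃ u ∈ Γ, u.re = Φ.b

/-- The trace of `closure Λ` on the right side `re = b`. [cite: SchrammSmirnov2011, proof of Lemma 6.1] -/
def wallTrace (ω : BondConfig (Site 2)) : Set ℂ := closure (Φ.explored ω) ∩ {u | u.re = Φ.b}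

/-- **The height of `x`**: the largest `im` of a point of `closure Λ` on the right side.
[cite: SchrammSmirnov2011, proof of Lemma 6.1] -/
def wallTop (ω : BondConfig (Site 2)) : ℝ := sSup (im '' Φ.wallTrace ω)

/-- **`x`, the endpoint of the lowest crossing on `∂₂`**: the highest point of `closure Λ` on the
right side `re = b` (chart coordinates). [cite: SchrammSmirnov2011, proof of Lemma 6.1] -/
def wallPt (ω : BondConfig (Site 2)) : ℂ := ⟨Φ.b, Φ.wallTop ω⟩

/-- `re x = b`. [folklore] -/
@[simp] theorem wallPt_re (ω : BondConfig (Site 2)) : (Φ.wallPt ω).re = Φ.b := rfl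

/-- `im x = wallTop`. [folklore] -/
@[simp] theorem wallPt_im (ω : BondConfig (Site 2)) : (Φ.wallPt ω).im = Φ.wallTop ω := rfl

/-- The rectangle `R₁⁺ = [a, b+s] × [c-η, d]` used for the separation arguments (`s > 0`). [folklore] -/
def bigRect (s : ℝ) : Set ℂ := Icc Φ.a (Φ.b + s) ×ℂ Icc (Φ.c - Φ.η) Φ.d

/-- **The separating set** `Γ ∪ [b, b+s] × {y}`. [cite: SchrammSmirnov2011, proof of Lemma 6.1] -/
def sepSet (Γ : Set ℂ) (s y : ℝ) : Set ℂ := Γ ∪ Icc Φ.b (Φ.b + s) ×ℂ ({y} : Set ℝ)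

/-- **Joined below the separating set**: joined to the bottom side of `R₁⁺` inside
`R₁⁺ ∖ sepSet`. [cite: SchrammSmirnov2011, proof of Lemma 6.1] -/
def JoinedBelow (S : Set ℂ) (s : ℝ) (u : ℂ) : Prop :=
  ∃ p : ℂ, p.re ∈ Icc Φ.a (Φ.b + s) ∧ p.im = Φ.c - Φ.η ∧ JoinedIn (Φ.bigRect s \ S) p u

/-- The horizontal segment `[b, b+s] × {im x}` to the right of `x`. [cite: SchrammSmirnov2011, proof of Lemma 6.1] -/
def gapSeg (ω : BondConfig (Site 2)) (s : ℝ) : Set ℂ := Icc Φ.b (Φ.b + s) ×ℂ ({Φ.wallTop ω} : Set ℝ)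

/-- `R = [a, b+Δ] × [c,d]`, the chart rectangle of the larger quad. [cite: SchrammSmirnov2011, proof of Lemma 6.1] -/
def wideRect : Set ℂ := Icc Φ.a (Φ.b + Φ.Δ) ×ℂ Icc Φ.c Φ.d

/-- The top-right corner `(b, d)` of `R'`. [folklore] -/
def corner : ℂ := ⟨Φ.b, Φ.d⟩

/-- **Calibration of a frame** at chart scale `κ` (distance of `x` from the top side) and plane
scales `ρ₀` (inner), `R⋆` (outer), `Rₐ` (localisation), `ω₁` (chart size of an edge): the chart
rectangles sit in `[-2,2]²` with sides `≥ 1`, margin `η = 1/8`, `Δ ≤ 1`, `0 < κ ≤ 1/4`; the chart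
`G` moves points at chart distance `≤ max Δ (4ω₁)` by `≤ 2ρ₀`; `G⁻¹` shrinks drawn edges to chart
size `≤ ω₁ ≤ κ/8` and plane distances `≤ Rₐ` to chart distances `≤ κ/4`; and `4ρ₀ ≤ R⋆`,
`R⋆ + 2δ ≤ Rₐ`, `2δ ≤ ρ₀`.  (All are met for small `Δ`, then small `δ`, by uniform continuity of
`G`, `G⁻¹` on compact sets.) [cite: SchrammSmirnov2011, proof of Lemma 6.1] -/
structure Calib (κ ρ₀ Rs ω₁ Rₐ : ℝ) : Prop where
  ha : -2 ≤ Φ.a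
  hb : Φ.b + Φ.Δ ≤ 2
  hc : -2 ≤ Φ.c - Φ.η
  hd : Φ.d ≤ 2
  hw : 1 ≤ Φ.b - Φ.a
  hh : 1 ≤ Φ.d - Φ.c
  hη : Φ.η = 1 / 8
  hΔ1 : Φ.Δ ≤ 1
  hκ : 0 < κ
  hκ' : κ ≤ 1 / 4
  hω₁ : 0 ≤ ω₁
  hω₁' : ω₁ ≤ κ / 8
  hmodG : ∀ u v : ℂ, ‖u‖ ≤ 5 → ‖v‖ ≤ 5 → dist u v ≤ max Φ.Δ (4 * ω₁) →
    dist (Φ.G u) (Φ.G v) ≤ 2 * ρ₀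
  hmodInv : ∀ p q : ℂ, ‖Φ.G.symm p‖ ≤ 5 → dist p q ≤ 2 * Φ.δ →
    dist (Φ.G.symm p) (Φ.G.symm q) ≤ ω₁
  hRₐ : ∀ u v : ℂ, ‖u‖ ≤ 5 → ‖v‖ ≤ 5 → dist (Φ.G u) (Φ.G v) ≤ Rₐ → dist u v ≤ κ / 4
  hρ₀ : 0 < ρ₀
  h4 : 4 * ρ₀ ≤ Rs
  hRw : Rs + 2 * Φ.δ ≤ Rₐ
  hδρ : 2 * Φ.δ ≤ ρ₀

/-- The centre of the arm event as a function of the explored region alone. [folklore] -/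
def armCentre (Λ₀ : Set ℂ) : ℂ :=
  Φ.G ⟨Φ.b, sSup (im '' (closure Λ₀ ∩ {u : ℂ | u.re = Φ.b}))⟩

end Frame

/-- **Swap of the chart coordinates** `x + iy ↦ y + ix` (an involutive homeomorphism; it
exchanges the roles of the vertical and horizontal sides of chart rectangles). [folklore] -/
def swapC : ℂ ≃ₜ ℂ where
  toFun z := ⟨z.im, z.re⟩
  invFun z := ⟨z.im, z.re⟩
  left_inv z := by cases z; rfl
  right_inv z := by cases z; rfl
  continuous_toFun := by
    have : (fun z : ℂ => (⟨z.im, z.re⟩ : ℂ)) = fun z => (z.im : ℂ) + (z.re : ℂ) * I := by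
      funext z; apply Complex.ext <;> simp
    rw [this]; fun_prop
  continuous_invFun := by
    have : (fun z : ℂ => (⟨z.im, z.re⟩ : ℂ)) = fun z => (z.im : ℂ) + (z.re : ℂ) * I := by
      funext z; apply Complex.ext <;> simp
    rw [this]; fun_prop

/-- `re (swapC z) = im z`. [folklore] -/
@[simp] theorem swapC_re (z : ℂ) : (swapC z).re = z.im := rfl

/-- `im (swapC z) = re z`. [folklore] -/
@[simp] theorem swapC_im (z : ℂ) : (swapC z).im = z.re := rfl

/-- `swapC` is an involution. [folklore] -/
@[simp] theorem swapC_swapC (z : ℂ) : swapC (swapC z) = z := by cases z; rfl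

/-- The shift of the dual lattice at mesh `δ`: `δ (½, ½)`. [cite: BollobasRiordan2006, Ch. 1 p. 15 (Fig. 9, PDF page)] -/
def dualShift (δ : ℝ) : ℂ := (δ : ℂ) * dualOffset

/-- Reflection in the imaginary axis of the chart: `x + iy ↦ -x + iy`. [folklore] -/
def negRe : ℂ ≃ₜ ℂ where
  toFun z := ⟨-z.re, z.im⟩
  invFun z := ⟨-z.re, z.im⟩
  left_inv z := by cases z; simp
  right_inv z := by cases z; simp
  continuous_toFun := by
    have : (fun z : ℂ => (⟨-z.re, z.im⟩ : ℂ)) = fun z => -((z.re : ℂ)) + (z.im : ℂ) * Complex.I := by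
      funext z; apply Complex.ext <;> simp
    rw [this]; fun_prop
  continuous_invFun := by
    have : (fun z : ℂ => (⟨-z.re, z.im⟩ : ℂ)) = fun z => -((z.re : ℂ)) + (z.im : ℂ) * Complex.I := by
      funext z; apply Complex.ext <;> simp
    rw [this]; fun_prop

/-- Reflection in the real axis of the chart: `x + iy ↦ x - iy`. [folklore] -/
def negIm : ℂ ≃ₜ ℂ where
  toFun z := ⟨z.re, -z.im⟩
  invFun z := ⟨z.re, -z.im⟩
  left_inv z := by cases z; simp
  right_inv z := by cases z; simp
  continuous_toFun := by
    have : (fun z : ℂ => (⟨z.re, -z.im⟩ : ℂ)) = fun z => ((z.re : ℂ)) - (z.im : ℂ) * Complex.I := by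
      funext z; apply Complex.ext <;> simp
    rw [this]; fun_prop
  continuous_invFun := by
    have : (fun z : ℂ => (⟨z.re, -z.im⟩ : ℂ)) = fun z => ((z.re : ℂ)) - (z.im : ℂ) * Complex.I := by
      funext z; apply Complex.ext <;> simp
    rw [this]; fun_prop

/-- `re (negRe z) = -re z`. [folklore] -/
@[simp] theorem negRe_re (z : ℂ) : (negRe z).re = -z.re := rfl
/-- `im (negRe z) = im z`. [folklore] -/
@[simp] theorem negRe_im (z : ℂ) : (negRe z).im = z.im := rfl
/-- `re (negIm z) = re z`. [folklore] -/
@[simp] theorem negIm_re (z : ℂ) : (negIm z).re = z.re := rfl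
/-- `im (negIm z) = -im z`. [folklore] -/
@[simp] theorem negIm_im (z : ℂ) : (negIm z).im = -z.im := rfl
/-- `negRe` is an involution. [folklore] -/
@[simp] theorem negRe_negRe (z : ℂ) : negRe (negRe z) = z := by cases z; simp [negRe]
/-- `negIm` is an involution. [folklore] -/
@[simp] theorem negIm_negIm (z : ℂ) : negIm (negIm z) = z := by cases z; simp [negIm]

end SSContinuity

end Literature.Probability.Percolation
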